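import Mathlib
import HarnessLib
import Summits.ResolutionOfSingularities.ResolutionOfSingularities.Theorems.WildQuotientsWildQuotientResolutionS1aModelTools

/-!
# S1a — THE RECOORDINATION STEP: a triangular shear of the free model `k[T_ι][1/h] ≃ k[T_ι][1/h′]` with pins (for centres that are variables only after a
# triangular change of coordinates, e.g. MT-D₄'s move 2 along `z = e₁ − x₃`)

[OURS · L1 W4.5c · lead-1 g13; plan-1 R-F15d / X-CERT v1.1 §0 (S1) move 2 «centre P̃₃ = V(z, x₁′), z := e₁ − x₃ (linear recoordination of N(x₂))»,
FRAME-STATUS rev16 §3] — NOT statements of the manuscript; counted 0; AI-level work, weaker than expert review. Crux stmt-ResolutionOfSingularities-17941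
`CyclicQuotientFourfolds`, line `s1a-logminvertex` v13 (`stub_reachLowerInFX`). Pure commutative algebra, stated as existence with pins (no definitions).

* `exists_shear` — the triangular `k`-algebra automorphism `T_{l₀} ↦ T_{l₀} + q` (`q` not involving `T_{l₀}`; e.g. `x₂ ↦ x₂ − s·X₁′` so that
  D₄'s `z = x₁ − x₂ = sX₁′ − x₂` becomes a variable), all other variables fixed, with its pins;
* `exists_awayEquiv_of_algEquiv` — any `k`-algebra automorphism `α` of `k[T_ι]` induces `k[T_ι][1/h] ≃+* k[T_ι][1/α h]` over `α`;
* ★ `exists_shearAwayEquiv` — the composite: `Θ : k[T_ι][1/h] ≃+* k[T_ι][1/h′]` with `Θ(T_{l₀}) = T_{l₀} + q`, `Θ(T_l) = T_l` (`l ≠ l₀`), `Θ(h⁻¹) = h′⁻¹`, and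
  `h′ = α h` — so a node modelled on `k[T][1/h]` is re-modelled (compose the model iso with `Θ`) on coordinates in which the next centre is a family of
  variables, and ✓`exists_chartFreeModelEquiv` / ✓`isRegular_algebraMap_X_away` apply again.
-/

set_option linter.dupNamespace false

noncomputable section

open MvPolynomial

namespace Summit.ResolutionOfSingularities.ResolutionOfSingularities.Theorems.WildQuotientResolution.S1.FreeModel

variable (k : Type) [CommRing k] {ι : Type} [DecidableEq ι]

/-- **The triangular shear** `T_{l₀} ↦ T_{l₀} + q` (`q` not involving `T_{l₀}`), all other variables fixed, is a `k`-algebra automorphism of `k[T_ι]`.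
[folklore] -/
theorem exists_shear (l₀ : ι) (q : MvPolynomial ι k) (hq : l₀ ∉ q.vars) :
    ∃ α : MvPolynomial ι k ≃ₐ[k] MvPolynomial ι k, α (X l₀) = X l₀ + q ∧ (∀ l, l ≠ l₀ → α (X l) = X l) ∧
      α.symm (X l₀) = X l₀ - q ∧ (∀ l, l ≠ l₀ → α.symm (X l) = X l) := by
  let f : MvPolynomial ι k →ₐ[k] MvPolynomial ι k := aeval fun l => if l = l₀ then X l₀ + q else X l
  let g : MvPolynomial ι k →ₐ[k] MvPolynomial ι k := aeval fun l => if l = l₀ then X l₀ - q else X l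
  have hf0 : f (X l₀) = X l₀ + q := by rw [aeval_X, if_pos rfl]
  have hf : ∀ l, l ≠ l₀ → f (X l) = X l := fun l h => by rw [aeval_X, if_neg h]
  have hg0 : g (X l₀) = X l₀ - q := by rw [aeval_X, if_pos rfl]
  have hg : ∀ l, l ≠ l₀ → g (X l) = X l := fun l h => by rw [aeval_X, if_neg h]
  -- `q` is fixed by both substitutions (it does not involve `T_{l₀}`)
  have hfix : ∀ (φ : MvPolynomial ι k →ₐ[k] MvPolynomial ι k), (∀ l, l ≠ l₀ → φ (X l) = X l) → φ q = q := by
    intro φ hφ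
    have h := hom_congr_vars (f₁ := (φ : MvPolynomial ι k →+* MvPolynomial ι k)) (f₂ := RingHom.id _) (p₁ := q) (p₂ := q)
      (by ext a; simp) (fun i hi _ => by
        have hi' : i ≠ l₀ := fun h => hq (h ▸ hi)
        rw [RingHom.coe_coe, hφ i hi', RingHom.id_apply]) rfl
    simpa using h
  have hfg : f.comp g = AlgHom.id k _ := by
    refine algHom_ext fun l => ?_
    by_cases h : l = l₀
    · subst h
      rw [AlgHom.comp_apply, hg0, map_sub, AlgHom.id_apply, hf0, hfix f hf]
      ring
    · rw [AlgHom.comp_apply, hg l h, AlgHom.id_apply, hf l h]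
  have hgf : g.comp f = AlgHom.id k _ := by
    refine algHom_ext fun l => ?_
    by_cases h : l = l₀
    · subst h
      rw [AlgHom.comp_apply, hf0, map_add, AlgHom.id_apply, hg0, hfix g hg]
      ring
    · rw [AlgHom.comp_apply, hf l h, AlgHom.id_apply, hg l h]
  refine ⟨AlgEquiv.ofAlgHom f g hfg hgf, hf0, hf, hg0, hg⟩

omit [DecidableEq ι] in
/-- **A `k`-algebra automorphism of `k[T_ι]` induces `k[T_ι][1/h] ≃+* k[T_ι][1/α h]`** over it. [folklore] -/
theorem exists_awayEquiv_of_algEquiv (α : MvPolynomial ι k ≃ₐ[k] MvPolynomial ι k) (hh : MvPolynomial ι k) :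
    ∃ Θ : Localization.Away hh ≃+* Localization.Away (α hh),
      ∀ a : MvPolynomial ι k, Θ (algebraMap (MvPolynomial ι k) (Localization.Away hh) a) = algebraMap (MvPolynomial ι k) (Localization.Away (α hh)) (α a) := by
  have H : (Submonoid.powers hh).map α.toRingEquiv.toMonoidHom = Submonoid.powers (α hh) := by
    rw [Submonoid.map_powers]; rfl
  exact ⟨IsLocalization.ringEquivOfRingEquiv (M := Submonoid.powers hh) (T := Submonoid.powers (α hh)) (Localization.Away hh) (Localization.Away (α hh))
    α.toRingEquiv H, fun a => IsLocalization.ringEquivOfRingEquiv_eq H a⟩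

/-- ★ **THE RECOORDINATION STEP**: the triangular shear `T_{l₀} ↦ T_{l₀} + q` on the localised free model, with pins on the variables, the constants and
`h⁻¹`. [OURS · L1 W4.5c · (F-T8) models; NOT a statement of the manuscript] -/
theorem exists_shearAwayEquiv (l₀ : ι) (q : MvPolynomial ι k) (hq : l₀ ∉ q.vars) (hh : MvPolynomial ι k) :
    ∃ (α : MvPolynomial ι k ≃ₐ[k] MvPolynomial ι k) (Θ : Localization.Away hh ≃+* Localization.Away (α hh)),
      α (X l₀) = X l₀ + q ∧ (∀ l, l ≠ l₀ → α (X l) = X l) ∧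
      (∀ b : MvPolynomial ι k, Θ (algebraMap (MvPolynomial ι k) (Localization.Away hh) b) = algebraMap (MvPolynomial ι k) (Localization.Away (α hh)) (α b)) ∧
      Θ (algebraMap (MvPolynomial ι k) (Localization.Away hh) (X l₀)) =
        algebraMap (MvPolynomial ι k) (Localization.Away (α hh)) (X l₀) + algebraMap (MvPolynomial ι k) (Localization.Away (α hh)) q ∧
      (∀ l, l ≠ l₀ → Θ (algebraMap (MvPolynomial ι k) (Localization.Away hh) (X l)) = algebraMap (MvPolynomial ι k) (Localization.Away (α hh)) (X l)) ∧
      Θ (IsLocalization.Away.invSelf hh) = IsLocalization.Away.invSelf (α hh) := by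
  obtain ⟨α, h0, h1, -, -⟩ := exists_shear k l₀ q hq
  obtain ⟨Θ, hΘ⟩ := exists_awayEquiv_of_algEquiv k α hh
  refine ⟨α, Θ, h0, h1, hΘ, by rw [hΘ, h0, map_add], fun l h => by rw [hΘ, h1 l h], ?_⟩
  -- the inverted element goes to the inverted element
  have h1Θ : Θ (algebraMap (MvPolynomial ι k) (Localization.Away hh) hh) * Θ (IsLocalization.Away.invSelf hh) = 1 := by
    rw [← map_mul, IsLocalization.Away.mul_invSelf, map_one]
  rw [hΘ] at h1Θ
  have h2 : algebraMap (MvPolynomial ι k) (Localization.Away (α hh)) (α hh) * IsLocalization.Away.invSelf (α hh) = 1 := IsLocalization.Away.mul_invSelf _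
  have hu : IsUnit (algebraMap (MvPolynomial ι k) (Localization.Away (α hh)) (α hh)) := IsLocalization.Away.algebraMap_isUnit _
  exact hu.mul_left_cancel (h1Θ.trans h2.symm)

end Summit.ResolutionOfSingularities.ResolutionOfSingularities.Theorems.WildQuotientResolution.S1.FreeModel

end
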